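import Summits.AtomisticToContinuum.FouriersLaw.Theses.OddSectorIrreversibility
import Summits.AtomisticToContinuum.FouriersLaw.Theorems.BoundedResponseConverges.Negative.LoadBearing
import Summits.AtomisticToContinuum.FouriersLaw.Theorems.FourierGreenKuboFourierFiniteResponseOfUnique
import Literature.Barriers.AtomisticToContinuum.FixedLengthNoConductivityControl

/-!
# Crux `BoundedResponseConverges` (stmt-AtomisticToContinuum-9141) — strategist REDIRECT r1, typed companion

§1 `fouriersLaw_iff_boundedResponse_and_boundedResponseConverges` — THE SUMMIT-STRENGTH CERTIFICATE of the crux: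
with the route's two fixed-`N` cruxes PROVED in tree (`NessUnique_holds`, `finiteResponseOfUnique_holds`) and the
steady states constructed (`pinnedChain_exists_isSteadyState`), the sub-problem statement is EXACTLY the conjunction
of the catalogued necessary waypoint `BoundedResponse` (stmt-10924, = `HasBoundedResponse (pinnedChain …)` under
uniqueness) and this crux:

  `FouriersLaw ↔ BoundedResponse ∧ BoundedResponseConverges`.

So the crux is the RESIDUAL CONJUNCT of a two-conjunct split of `S`: route OddSectorIrreversibility attacks
`BoundedResponse` (E1 ∧ E2 ∧ P ⇒ WitnessGlue ⇒ 10924), and 9141 is, with no slack, "`S` minus 10924". Nothing about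
the route's mechanism bears on it; no strategy for it can be "short of the summit's second half" because it IS that
half (D-0033 tribunal: conjunct split — declare `residual: BoundedResponseConverges`).

§2 `boundedResponseConverges_of_subs'` — re-export, over this route's decl, of the landed exact split
12238 ∧ 11749 ⇒ 9141 through the import-cycle-free carrier (p153601), i.e. the `--glue-by` term for
`route edit --split BoundedResponseConverges` on THIS route.

No `sorry`; standard axioms.
-/

noncomputable section

namespace Summit.AtomisticToContinuum.FouriersLaw.Cruxes.BoundedResponseConverges.StrategistR1

open MeasureTheory Filter Topology Set
open Literature.MathematicalPhysics.KineticTheory.HeatConduction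
open Summit.AtomisticToContinuum.FouriersLaw.Theses.OddSectorIrreversibility

/-- `FouriersLaw → BoundedResponse`: the catalogued necessity
`Literature.Barriers.AtomisticToContinuum.hasBoundedResponse_of_fouriersLawFor`, re-typed on the route decl (the
uniqueness antecedent is not needed). [cite: BonettoLebowitzReyBellet2000, §6.3] -/
theorem boundedResponse_of_fouriersLaw (hF : _root_.FouriersLaw) : BoundedResponse := by
  intro ω₂ lam β γ hω hl hβ hγ _hu μ hμ T hT D hD
  exact Literature.Barriers.AtomisticToContinuum.hasBoundedResponse_of_fouriersLawFor
    (hF ω₂ lam β γ hω hl hβ hγ) μ hμ T hT D hD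

/-- `BoundedResponse → BoundedResponseConverges → FouriersLaw`, using ONLY landed theorems for the fixed-`N` inputs
(`NessUnique_holds`, `finiteResponseOfUnique_holds`, `pinnedChain_exists_isSteadyState`): the proof of the route's
`closes` with `WitnessGlue hP hE1 hE2` replaced by the hypothesis `BoundedResponse`. [folklore] -/
theorem fouriersLaw_of_boundedResponse_of_boundedResponseConverges
    (hB : BoundedResponse) (hBC : BoundedResponseConverges) : _root_.FouriersLaw := by
  show Literature.MathematicalPhysics.KineticTheory.HeatConduction.FouriersLaw
  unfold Literature.MathematicalPhysics.KineticTheory.HeatConduction.FouriersLaw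
  intro ω₂ lam β γ hω hl hβ hγ
  have hUq := NessUnique_holds ω₂ lam β γ hω hl hβ hγ
  have hBq := hB ω₂ lam β γ hω hl hβ hγ hUq
  have hex : ∀ (N : ℕ) (T_L T_R : ℝ), 0 < T_L → 0 < T_R →
      ∃ μ : Measure (PhaseSpace N), (pinnedChain ω₂ lam β γ).IsSteadyState N T_L T_R μ :=
    fun N T_L T_R h1 h2 => pinnedChain_exists_isSteadyState hω hl hβ hγ N h1 h2
  unfold OscillatorChain.FouriersLawFor
  refine ⟨fun N T_L T_R h1 h2 => ?_, ?_⟩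
  · obtain ⟨μ, hμ⟩ := hex N T_L T_R h1 h2
    exact ⟨μ, hμ, fun ν hν => hUq N T_L T_R h1 h2 ν μ hν hμ⟩
  classical
  let μ₀ : (N : ℕ) → ℝ → ℝ → Measure (PhaseSpace N) :=
    fun N T_L T_R => if h : 0 < T_L ∧ 0 < T_R then Classical.choose (hex N T_L T_R h.1 h.2) else 0
  have hμ₀ : ∀ (N : ℕ) (T_L T_R : ℝ), 0 < T_L → 0 < T_R →
      (pinnedChain ω₂ lam β γ).IsSteadyState N T_L T_R (μ₀ N T_L T_R) := by
    intro N T_L T_R h1 h2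
    have h12 : 0 < T_L ∧ 0 < T_R := ⟨h1, h2⟩
    simp only [μ₀, dif_pos h12]
    exact Classical.choose_spec (hex N T_L T_R h1 h2)
  have hD : ∀ T : ℝ, 0 < T → ∀ N : ℕ, ∃ D : ℝ,
      Tendsto (fun δ : ℝ => (pinnedChain ω₂ lam β γ).totalCurrent (μ₀ N (T + δ / 2) (T - δ / 2)) / δ)
        (𝓝[≠] 0) (𝓝 D) :=
    fun T hT N =>
      Summit.AtomisticToContinuum.FouriersLaw.Theorems.FourierGreenKubo.finiteResponseOfUnique_holds
        ω₂ lam β γ hω hl hβ hγ hUq μ₀ hμ₀ T hT N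
  let D₀ : ℝ → ℕ → ℝ := fun T N => if hT : 0 < T then Classical.choose (hD T hT N) else 0
  have hD₀ : ∀ T : ℝ, 0 < T → ∀ N : ℕ,
      Tendsto (fun δ : ℝ => (pinnedChain ω₂ lam β γ).totalCurrent (μ₀ N (T + δ / 2) (T - δ / 2)) / δ)
        (𝓝[≠] 0) (𝓝 (D₀ T N)) := by
    intro T hT N
    simp only [D₀, dif_pos hT]
    exact Classical.choose_spec (hD T hT N)
  have hbdd : ∀ T : ℝ, 0 < T → BddAbove (Set.range fun N => |D₀ T N|) :=
    fun T hT => hBq μ₀ hμ₀ T hT (D₀ T) (hD₀ T hT)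
  have hconv : ∀ T : ℝ, 0 < T → ∃ k : ℝ, 0 < k ∧ Tendsto (D₀ T) atTop (𝓝 k) :=
    fun T hT => hBC ω₂ lam β γ hω hl hβ hγ hUq μ₀ hμ₀ T hT (D₀ T) (hD₀ T hT) (hbdd T hT)
  let κ : ℝ → ℝ := fun T => if hT : 0 < T then Classical.choose (hconv T hT) else 1
  refine ⟨κ, fun T hT => ?_, ?_⟩
  · simp only [κ, dif_pos hT]
    exact (Classical.choose_spec (hconv T hT)).1
  intro μ hμ T hT
  refine ⟨D₀ T, fun N => ?_, ?_⟩
  · have key : ∀ᶠ δ in 𝓝[≠] (0 : ℝ),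
        (pinnedChain ω₂ lam β γ).totalCurrent (μ₀ N (T + δ / 2) (T - δ / 2)) / δ =
          (pinnedChain ω₂ lam β γ).totalCurrent (μ N (T + δ / 2) (T - δ / 2)) / δ := by
      have h2 : ∀ᶠ δ in 𝓝 (0 : ℝ), δ < 2 * T := eventually_lt_nhds (by linarith)
      have h2' : ∀ᶠ δ in 𝓝 (0 : ℝ), -(2 * T) < δ := eventually_gt_nhds (by linarith)
      filter_upwards [mem_nhdsWithin_of_mem_nhds h2, mem_nhdsWithin_of_mem_nhds h2'] with δ hlt hgt
      have ha : 0 < T + δ / 2 := by linarith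
      have hb : 0 < T - δ / 2 := by linarith
      rw [hUq N _ _ ha hb _ _ (hμ₀ N _ _ ha hb) (hμ N _ _ ha hb)]
    exact (hD₀ T hT N).congr' key
  · simp only [κ, dif_pos hT]
    exact (Classical.choose_spec (hconv T hT)).2

/-- **Summit-strength certificate (conjunct split).** With the fixed-`N` theory landed, Fourier's law for the pinned
anharmonic chain is EXACTLY bounded response (stmt-10924) AND this crux (stmt-9141); the crux is the residual conjunct
"`S` minus `HasBoundedResponse`", BLR's convergence half. [cite: BonettoLebowitzReyBellet2000, §5.3 eq. (33) and §6.3] -/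
theorem fouriersLaw_iff_boundedResponse_and_boundedResponseConverges :
    _root_.FouriersLaw ↔ (BoundedResponse ∧ BoundedResponseConverges) :=
  ⟨fun hF => ⟨boundedResponse_of_fouriersLaw hF,
      Classical.byContradiction fun h =>
        Summit.AtomisticToContinuum.FouriersLaw.Theorems.not_fouriersLaw_of_not_boundedResponseConverges h hF⟩,
    fun h => fouriersLaw_of_boundedResponse_of_boundedResponseConverges h.1 h.2⟩

/-- Given bounded response (the route's OWN target through `WitnessGlue`), the crux is EQUIVALENT to the summit
conjunct — the typed meaning of "no strategy short of the summit" for this node. [folklore] -/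
theorem boundedResponseConverges_iff_fouriersLaw_of_boundedResponse (hB : BoundedResponse) :
    BoundedResponseConverges ↔ _root_.FouriersLaw :=
  ⟨fun hBC => fouriersLaw_of_boundedResponse_of_boundedResponseConverges hB hBC,
    fun hF => (fouriersLaw_iff_boundedResponse_and_boundedResponseConverges.mp hF).2⟩

end Summit.AtomisticToContinuum.FouriersLaw.Cruxes.BoundedResponseConverges.StrategistR1
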